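import Summits.AtomisticToContinuum.Crystallization.Theorems.HullExactificationCascadeRobustBarlowTemplateTransportDefs
import Summits.AtomisticToContinuum.Crystallization.Theorems.HullExactificationCascadeRobustBarlowTemplateDevelopCharts
import Summits.AtomisticToContinuum.Crystallization.Theorems.HullExactificationCascadeRobustBarlowTemplateStubReciprocity
import Summits.AtomisticToContinuum.Crystallization.Theorems.PalmUnimodularRigidityShellsToBarlowChartCharts
import Summits.AtomisticToContinuum.Crystallization.Theorems.GappedShellCensusCleanLimitsHaveWindowsCleanChartLinks

/-!
# `develop_transfer` for line `registered` (crux `RobustBarlowTemplate`, stmt-AtomisticToContinuum-12088)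

## Statement
`develop_transfer` (registered sub-goal toward `develop_transport`): THE TRANSFER LEMMA at tolerance
`1/20`.  Let `x, y` be two mutually shell-adjacent sites (`y ∈ shell S x`, `x ∈ shell S y`) carrying
scale-relative integer charts `IsZChart S x P A nbr`, `IsZChart S y Py Ay ny`, and let `z, z'` be
two points each of which is `x` (label `0`) or a labelled shell point of `x`, AND `y` (label `0`) or
a labelled shell point of `y`.  Then the squared label distance of `z, z'` read at `y` equals the
one read at `x`.  This is the one place of the development where the tolerance `1/20` is spent.

## Proof outline (`d = nnd S x`, `d' = nnd S y`)
* READINGS (`transfer_reading`): two `x`-labelled points are at distance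
  `d · √(D/18) ± d/10`, `D` the squared label distance (each point is within `d/20` of its ideal
  position).
* SCALES TIED SHARPLY (`transfer_tied`): `d ≤ dist y x` (infimum) and `dist x y ≤ 21/20 · d'`
  (`x` is a labelled shell point of `y`), so `20 d ≤ 21 d'`, and symmetrically.
* METRIC SEPARATION (`transfer_gap`, `transfer_metric`): with these readings and ties the pairs
  of spectrum values `(0, ≥ 18)`, `(18, ≥ 36)` and `(36, 54)` cannot be read at the two ends
  (worst margin `36` vs `54`: `21 · 6 + 4.1 · √18 = 143.40 < 146.97 = 20 · √54`).
* COMBINATORICS: if the reading at `x` exceeds `18` then `z, z'` are two distinct COMMON shell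
  points of `x` and `y`; their labels at `x` lie in the vertex figure of the label `t_y` of `y`
  (exact links), so the reading lies in `{36, 48, 54}` (`transfer_figure`, by `decide`), and the
  value `48` is characterised INTRINSICALLY: it is read iff some third common shell point is
  shell-adjacent to both `z` and `z'` (`transfer_apex`, by `decide`: the figure is a perfect
  matching `2K₂` except at basal HCP labels where it is a path `P₃` plus an isolated label, the
  `48`-pair being the two ends of the path).  Exact links transport this characterisation to `y`
  (`transfer_48`), so `48` is read at `x` iff at `y`.
* ASSEMBLY (`transfer_core`, `develop_transfer`): if the two readings differ, say `D < D'`, the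
  metric separation forces `D ≥ 36`, the combinatorics force `D, D' ∈ {36, 48, 54}` with `48`
  on neither or both sides, leaving `(36, 54)`, which is metrically excluded.

## Contents
* pattern tables `transfer_figure_*`, `transfer_apex_*` (by `decide`) and their uniform versions;
* label bookkeeping `transfer_sqNormInt_*`, `transfer_xlabel_mem`, `transfer_labels` (labels have
  squared norm `18`: `CleanHull.sqNormInt_label`, imported);
* metric lemmas `transfer_nnd_pos`, `transfer_norm_ideal`, `transfer_dist_nbr_le`,
  `transfer_tied`, `transfer_dist_xlabel`, `transfer_reading`, `transfer_gap`, `transfer_metric`;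
* combinatorial transport `transfer_adj`, `transfer_mem5`, `transfer_48`;
* `transfer_core` and the registered `develop_transfer`.
-/

noncomputable section

namespace Summit.AtomisticToContinuum.Crystallization.Theorems.HullExactificationCascadeRobustBarlowTemplate

open Literature.MathematicalPhysics.StatisticalMechanics Literature.Geometry.DiscreteGeometry
open Summit.AtomisticToContinuum.Crystallization.Theorems.PalmUnimodularRigidityShellsToBarlowChart
  (contacts fcc3Int)
open RealInnerProductSpace
open Summit.AtomisticToContinuum.Crystallization.Theorems.PalmUnimodularRigidityShellsToBarlowChart
  (sqNormInt_sub_mem_fcc3Int sqNormInt_sub_mem_hcpInt sqNormInt_neg norm_ideal dist_ideal sqrt_bounds)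
open Summit.AtomisticToContinuum.Crystallization.Theorems.CleanHull (sqNormInt_label)

/-- Euclidean `3`-space. -/
local notation "E3" => EuclideanSpace ℝ (Fin 3)

/-! ## Pattern tables (by `decide`) -/

/-- Vertex figures of `fcc3Int`: two labels touching a common label are at squared distance
`0, 18, 36, 48` or `54`. [folklore] -/
theorem transfer_figure_fcc3Int : ∀ ty ∈ fcc3Int, ∀ t ∈ fcc3Int, ∀ t' ∈ fcc3Int,
    sqNormInt (ty - t) = 18 → sqNormInt (ty - t') = 18 →
      sqNormInt (t - t') ∈ ({0, 18, 36, 48, 54} : Finset ℤ) := by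
  decide

/-- Vertex figures of `hcpInt`: two labels touching a common label are at squared distance
`0, 18, 36, 48` or `54`. [folklore] -/
theorem transfer_figure_hcpInt : ∀ ty ∈ hcpInt, ∀ t ∈ hcpInt, ∀ t' ∈ hcpInt,
    sqNormInt (ty - t) = 18 → sqNormInt (ty - t') = 18 →
      sqNormInt (t - t') ∈ ({0, 18, 36, 48, 54} : Finset ℤ) := by
  decide

/-- Vertex figures of either pattern: two labels touching a common label are at squared distance
`0, 18, 36, 48` or `54`. [folklore] -/
theorem transfer_figure {P : Finset (Fin 3 → ℤ)} (hP : P = fcc3Int ∨ P = hcpInt)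
    {ty t t' : Fin 3 → ℤ} (hty : ty ∈ P) (ht : t ∈ P) (ht' : t' ∈ P)
    (h : sqNormInt (ty - t) = 18) (h' : sqNormInt (ty - t') = 18) :
    sqNormInt (t - t') ∈ ({0, 18, 36, 48, 54} : Finset ℤ) := by
  rcases hP with rfl | rfl
  · exact transfer_figure_fcc3Int ty hty t ht t' ht' h h'
  · exact transfer_figure_hcpInt ty hty t ht t' ht' h h'

/-- The `48`-pair of a vertex figure of `fcc3Int`, intrinsically: two distinct labels of the
figure of `ty` are at squared distance `48` iff a third label of the figure touches both (never,
in `fcc3Int`: the figure is a perfect matching). [folklore] -/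
theorem transfer_apex_fcc3Int : ∀ ty ∈ fcc3Int, ∀ t ∈ fcc3Int, ∀ t' ∈ fcc3Int,
    sqNormInt (ty - t) = 18 → sqNormInt (ty - t') = 18 → t ≠ t' →
      (sqNormInt (t - t') = 48 ↔
        ∃ t'' ∈ fcc3Int, sqNormInt (ty - t'') = 18 ∧ sqNormInt (t'' - t) = 18 ∧
          sqNormInt (t'' - t') = 18) := by
  decide

/-- The `48`-pair of a vertex figure of `hcpInt`, intrinsically: two distinct labels of the
figure of `ty` are at squared distance `48` iff a third label of the figure touches both (the two
ends of the path `P₃` in the figure of a basal label). [folklore] -/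
theorem transfer_apex_hcpInt : ∀ ty ∈ hcpInt, ∀ t ∈ hcpInt, ∀ t' ∈ hcpInt,
    sqNormInt (ty - t) = 18 → sqNormInt (ty - t') = 18 → t ≠ t' →
      (sqNormInt (t - t') = 48 ↔
        ∃ t'' ∈ hcpInt, sqNormInt (ty - t'') = 18 ∧ sqNormInt (t'' - t) = 18 ∧
          sqNormInt (t'' - t') = 18) := by
  decide

/-- The `48`-pair of a vertex figure of either pattern, intrinsically: two distinct labels of the
figure of `ty` are at squared distance `48` iff a third label of the figure touches both.
[folklore] -/
theorem transfer_apex {P : Finset (Fin 3 → ℤ)} (hP : P = fcc3Int ∨ P = hcpInt)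
    {ty t t' : Fin 3 → ℤ} (hty : ty ∈ P) (ht : t ∈ P) (ht' : t' ∈ P)
    (h : sqNormInt (ty - t) = 18) (h' : sqNormInt (ty - t') = 18) (hne : t ≠ t') :
    sqNormInt (t - t') = 48 ↔
      ∃ t'' ∈ P, sqNormInt (ty - t'') = 18 ∧ sqNormInt (t'' - t) = 18 ∧
        sqNormInt (t'' - t') = 18 := by
  rcases hP with rfl | rfl
  · exact transfer_apex_fcc3Int ty hty t ht t' ht' h h' hne
  · exact transfer_apex_hcpInt ty hty t ht t' ht' h h' hne

/-! ## Label bookkeeping -/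

/-- `sqNormInt 0 = 0`. [folklore] -/
theorem transfer_sqNormInt_zero : sqNormInt (0 : Fin 3 → ℤ) = 0 := by decide

/-- Squared label distances of either pattern lie in the spectrum `{0, 18, 36, 48, 54, 66, 72}`.
[folklore] -/
theorem transfer_sqNormInt_sub_mem {P : Finset (Fin 3 → ℤ)} (hP : P = fcc3Int ∨ P = hcpInt)
    {t t' : Fin 3 → ℤ} (ht : t ∈ P) (ht' : t' ∈ P) :
    sqNormInt (t - t') ∈ ({0, 18, 36, 48, 54, 66, 72} : Finset ℤ) := by
  rcases hP with rfl | rfl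
  · exact sqNormInt_sub_mem_fcc3Int t ht t' ht'
  · exact sqNormInt_sub_mem_hcpInt t ht t' ht'

/-- Extended labels (`0` for the centre) have squared distances in the spectrum. [folklore] -/
theorem transfer_xlabel_mem {x : E3} {P : Finset (Fin 3 → ℤ)} {nbr : (Fin 3 → ℤ) → E3}
    (hP : P = fcc3Int ∨ P = hcpInt) {z z' : E3} {t t' : Fin 3 → ℤ}
    (hz : (t = 0 ∧ z = x) ∨ (t ∈ P ∧ z = nbr t)) (hz' : (t' = 0 ∧ z' = x) ∨ (t' ∈ P ∧ z' = nbr t')) :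
    sqNormInt (t - t') ∈ ({0, 18, 36, 48, 54, 66, 72} : Finset ℤ) := by
  rcases hz with ⟨rfl, -⟩ | ⟨ht, -⟩ <;> rcases hz' with ⟨rfl, -⟩ | ⟨ht', -⟩
  · decide
  · rw [zero_sub, sqNormInt_neg, sqNormInt_label hP ht']; decide
  · rw [sub_zero, sqNormInt_label hP ht]; decide
  · exact transfer_sqNormInt_sub_mem hP ht ht'

/-- If the squared distance of two extended labels exceeds `18`, both are pattern labels.
[folklore] -/
theorem transfer_labels {x : E3} {P : Finset (Fin 3 → ℤ)} {nbr : (Fin 3 → ℤ) → E3}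
    (hP : P = fcc3Int ∨ P = hcpInt) {z z' : E3} {t t' : Fin 3 → ℤ}
    (hz : (t = 0 ∧ z = x) ∨ (t ∈ P ∧ z = nbr t)) (hz' : (t' = 0 ∧ z' = x) ∨ (t' ∈ P ∧ z' = nbr t'))
    (h : 18 < sqNormInt (t - t')) : (t ∈ P ∧ z = nbr t) ∧ (t' ∈ P ∧ z' = nbr t') := by
  rcases hz with ⟨rfl, rfl⟩ | h1 <;> rcases hz' with ⟨rfl, rfl⟩ | h2
  · rw [sub_self, transfer_sqNormInt_zero] at h; omega
  · rw [zero_sub, sqNormInt_neg, sqNormInt_label hP h2.1] at h; omega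
  · rw [sub_zero, sqNormInt_label hP h1.1] at h; omega
  · exact ⟨h1, h2⟩

/-! ## Metric lemmas -/

/-- A site with a nonempty shell has positive nearest-neighbour distance. [folklore] -/
theorem transfer_nnd_pos {S : Set E3} {x y : E3} (h : y ∈ shell S x) : 0 < nnd S x := by
  have h1 := h.2.2
  have h2 : 0 ≤ dist y x := dist_nonneg
  linarith

/-- The ideal position vector of a pattern label at scale `d` has norm `d`. [folklore] -/
theorem transfer_norm_ideal {d : ℝ} (hd : 0 ≤ d) (A : E3 →ₗᵢ[ℝ] E3) {P : Finset (Fin 3 → ℤ)}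
    (hP : P = fcc3Int ∨ P = hcpInt) {t : Fin 3 → ℤ} (ht : t ∈ P) :
    ‖(d * (Real.sqrt 18)⁻¹) • A (intVec t)‖ = d := by
  rw [norm_ideal hd, sqNormInt_label hP ht]
  push_cast
  rw [mul_assoc, inv_mul_cancel₀ (by positivity), mul_one]

/-- A labelled shell point is within `21/20 · d` of the centre. [folklore] -/
theorem transfer_dist_nbr_le {S : Set E3} {x : E3} {P : Finset (Fin 3 → ℤ)} {A : E3 →ₗᵢ[ℝ] E3}
    {nbr : (Fin 3 → ℤ) → E3} (hx : IsZChart S x P A nbr) (hd : 0 ≤ nnd S x) {t : Fin 3 → ℤ}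
    (ht : t ∈ P) : dist (nbr t) x ≤ nnd S x + nnd S x / 20 := by
  have h1 := hx.2.2.1 t ht
  have h2 : dist (x + (nnd S x * (Real.sqrt 18)⁻¹) • A (intVec t)) x = nnd S x := by
    rw [dist_eq_norm, add_sub_cancel_left, transfer_norm_ideal hd A hx.1 ht]
  have h3 := dist_triangle (nbr t) (x + (nnd S x * (Real.sqrt 18)⁻¹) • A (intVec t)) x
  linarith

/-- **Scales of mutually shell-adjacent charted sites are tied**: `20 · d(x) ≤ 21 · d(y)`.
[folklore] -/
theorem transfer_tied {S : Set E3} {x y : E3} {Py : Finset (Fin 3 → ℤ)} {Ay : E3 →ₗᵢ[ℝ] E3}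
    {ny : (Fin 3 → ℤ) → E3} (hy : IsZChart S y Py Ay ny) (hyx : y ∈ shell S x)
    (hxy : x ∈ shell S y) : 20 * nnd S x ≤ 21 * nnd S y := by
  have hd' := transfer_nnd_pos hxy
  have h1 : nnd S x ≤ dist y x := recip_nnd_le hyx.1 hyx.2.1
  obtain ⟨u, hu, hux⟩ := hy.2.1.surjOn hxy
  have h2 := transfer_dist_nbr_le hy hd'.le hu
  rw [hux, dist_comm] at h2
  linarith

/-- A point carrying the extended label `t` at `x` is within `d/20` of the ideal position of `t`.
[folklore] -/
theorem transfer_dist_xlabel {S : Set E3} {x : E3} {P : Finset (Fin 3 → ℤ)} {A : E3 →ₗᵢ[ℝ] E3}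
    {nbr : (Fin 3 → ℤ) → E3} (hx : IsZChart S x P A nbr) (hd : 0 ≤ nnd S x) {z : E3}
    {t : Fin 3 → ℤ} (hz : (t = 0 ∧ z = x) ∨ (t ∈ P ∧ z = nbr t)) :
    dist z (x + (nnd S x * (Real.sqrt 18)⁻¹) • A (intVec t)) ≤ nnd S x / 20 := by
  rcases hz with ⟨rfl, rfl⟩ | ⟨ht, rfl⟩
  · have h0 : intVec (0 : Fin 3 → ℤ) = 0 := by ext i; simp [intVec]
    rw [h0, map_zero, smul_zero, add_zero, dist_self]
    linarith
  · exact hx.2.2.1 t ht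

/-- **Reading a distance in a chart**: two points with extended labels `t, t'` at `x` are at
distance `(d/√18) · √(sqNormInt (t − t')) ± d/10`. [folklore] -/
theorem transfer_reading {S : Set E3} {x : E3} {P : Finset (Fin 3 → ℤ)} {A : E3 →ₗᵢ[ℝ] E3}
    {nbr : (Fin 3 → ℤ) → E3} (hx : IsZChart S x P A nbr) (hd : 0 ≤ nnd S x) {z z' : E3}
    {t t' : Fin 3 → ℤ} (hz : (t = 0 ∧ z = x) ∨ (t ∈ P ∧ z = nbr t))
    (hz' : (t' = 0 ∧ z' = x) ∨ (t' ∈ P ∧ z' = nbr t')) :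
    |dist z z' - nnd S x * (Real.sqrt 18)⁻¹ * Real.sqrt (sqNormInt (t - t') : ℝ)| ≤
      nnd S x / 10 := by
  have h1 := transfer_dist_xlabel hx hd hz
  have h2 := transfer_dist_xlabel hx hd hz'
  rw [← dist_ideal hd x A t t']
  set p : E3 := x + (nnd S x * (Real.sqrt 18)⁻¹) • A (intVec t)
  set p' : E3 := x + (nnd S x * (Real.sqrt 18)⁻¹) • A (intVec t')
  have e1 : |dist z z' - dist p z'| ≤ dist z p := _root_.abs_dist_sub_le z p z'
  have e2 : |dist z' p - dist p' p| ≤ dist z' p' := _root_.abs_dist_sub_le z' p' p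
  rw [dist_comm z' p, dist_comm p' p] at e2
  rw [abs_le] at e1 e2 ⊢
  constructor <;> linarith [e1.1, e1.2, e2.1, e2.2]

/-- **Spectrum gaps at tolerance `1/20`**: for the pairs `(0, ≥ 18)`, `(18, ≥ 36)`, `(36, 54)`
one has `21 √D + 4.1 √18 < 20 √D'` (worst: `143.40 < 146.97`). [folklore] -/
theorem transfer_gap {D D' : ℤ}
    (hcase : (D = 0 ∧ 18 ≤ D') ∨ (D = 18 ∧ 36 ≤ D') ∨ (D = 36 ∧ D' = 54)) :
    21 * Real.sqrt (D : ℝ) + 41 / 10 * Real.sqrt 18 < 20 * Real.sqrt (D' : ℝ) := by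
  obtain ⟨b18u, b18l, b36, -, -, b54l, -⟩ := sqrt_bounds
  rcases hcase with ⟨rfl, h⟩ | ⟨rfl, h⟩ | ⟨rfl, rfl⟩
  · have h1 : Real.sqrt 18 ≤ Real.sqrt (D' : ℝ) := Real.sqrt_le_sqrt (by exact_mod_cast h)
    have h0 : Real.sqrt ((0 : ℤ) : ℝ) = 0 := by rw [Int.cast_zero, Real.sqrt_zero]
    rw [h0]
    linarith
  · have h1 : Real.sqrt 36 ≤ Real.sqrt (D' : ℝ) := Real.sqrt_le_sqrt (by exact_mod_cast h)
    rw [b36] at h1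
    push_cast
    linarith
  · push_cast
    rw [b36]
    linarith

/-- **Metric exclusion**: a distance `r` cannot read `D` at scale `dx` and `D'` at scale `dy`
(tolerance `1/10` each) when `20 dx ≤ 21 dy` and `(D, D')` is one of the gapped pairs. [folklore] -/
theorem transfer_metric {dx dy r : ℝ} {D D' : ℤ} (hdy : 0 < dy) (htie : 20 * dx ≤ 21 * dy)
    (hcase : (D = 0 ∧ 18 ≤ D') ∨ (D = 18 ∧ 36 ≤ D') ∨ (D = 36 ∧ D' = 54))
    (h1 : |r - dx * (Real.sqrt 18)⁻¹ * Real.sqrt (D : ℝ)| ≤ dx / 10)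
    (h2 : |r - dy * (Real.sqrt 18)⁻¹ * Real.sqrt (D' : ℝ)| ≤ dy / 10) : False := by
  have hgap := transfer_gap hcase
  have h18 : (0 : ℝ) < Real.sqrt 18 := by positivity
  rw [abs_le] at h1 h2
  have e1 : dx * (Real.sqrt 18)⁻¹ * Real.sqrt (D : ℝ) * Real.sqrt 18 = dx * Real.sqrt (D : ℝ) := by
    field_simp
  have e2 : dy * (Real.sqrt 18)⁻¹ * Real.sqrt (D' : ℝ) * Real.sqrt 18 = dy * Real.sqrt (D' : ℝ) := by
    field_simp
  have k1 : dy * (Real.sqrt 18)⁻¹ * Real.sqrt (D' : ℝ) - dx * (Real.sqrt 18)⁻¹ * Real.sqrt (D : ℝ) ≤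
      dx / 10 + dy / 10 := by linarith
  have k2 : dy * Real.sqrt (D' : ℝ) - dx * Real.sqrt (D : ℝ) ≤ (dx / 10 + dy / 10) * Real.sqrt 18 := by
    have := mul_le_mul_of_nonneg_right k1 h18.le
    rwa [sub_mul, e1, e2] at this
  have k3 : 20 * dx * (Real.sqrt (D : ℝ) + Real.sqrt 18 / 10) ≤
      21 * dy * (Real.sqrt (D : ℝ) + Real.sqrt 18 / 10) :=
    mul_le_mul_of_nonneg_right htie (by positivity)
  have k4 : dy * (21 * Real.sqrt (D : ℝ) + 41 / 10 * Real.sqrt 18) < dy * (20 * Real.sqrt (D' : ℝ)) :=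
    mul_lt_mul_of_pos_left hgap hdy
  linarith

/-! ## Combinatorial transport along exact links -/

section Core

variable {S : Set E3} {x y : E3} {P Py : Finset (Fin 3 → ℤ)} {A Ay : E3 →ₗᵢ[ℝ] E3}
  {nbr ny : (Fin 3 → ℤ) → E3}

/-- A common labelled shell point `nbr t = ny u` of `x` and `y = nbr ty` has its `x`-label in
the figure of `ty`. [folklore] -/
theorem transfer_adj (hx : IsZChart S x P A nbr) (hy : IsZChart S y Py Ay ny)
    {ty t u : Fin 3 → ℤ} (hty : ty ∈ P) (hy_eq : nbr ty = y) (ht : t ∈ P) (hu : u ∈ Py)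
    (hzu : nbr t = ny u) : sqNormInt (ty - t) = 18 :=
  (hx.2.2.2 ty hty t ht).1 (by rw [hy_eq, hzu]; exact hy.2.1.mapsTo hu)

/-- Two common labelled shell points of `x` and `y ∈ shell S x` read `0, 18, 36, 48` or `54`
at `x`. [folklore] -/
theorem transfer_mem5 (hx : IsZChart S x P A nbr) (hy : IsZChart S y Py Ay ny)
    (hyx : y ∈ shell S x) {t t' u u' : Fin 3 → ℤ} (ht : t ∈ P) (ht' : t' ∈ P) (hu : u ∈ Py)
    (hu' : u' ∈ Py) (hzu : nbr t = ny u) (hzu' : nbr t' = ny u') :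
    sqNormInt (t - t') ∈ ({0, 18, 36, 48, 54} : Finset ℤ) := by
  obtain ⟨ty, hty, hy_eq⟩ := hx.2.1.surjOn hyx
  exact transfer_figure hx.1 hty ht ht' (transfer_adj hx hy hty hy_eq ht hu hzu)
    (transfer_adj hx hy hty hy_eq ht' hu' hzu')

/-- **Transport of the value `48`**: two common labelled shell points of mutually shell-adjacent
charted sites reading `48` at `x` read `48` at `y` (the intrinsic characterisation
`transfer_apex` is transported along the exact links). [folklore] -/
theorem transfer_48 (hx : IsZChart S x P A nbr) (hy : IsZChart S y Py Ay ny)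
    (hyx : y ∈ shell S x) (hxy : x ∈ shell S y) {t t' u u' : Fin 3 → ℤ} (ht : t ∈ P)
    (ht' : t' ∈ P) (hu : u ∈ Py) (hu' : u' ∈ Py) (hzu : nbr t = ny u) (hzu' : nbr t' = ny u')
    (h48 : sqNormInt (t - t') = 48) : sqNormInt (u - u') = 48 := by
  obtain ⟨ty, hty, hy_eq⟩ := hx.2.1.surjOn hyx
  obtain ⟨ux, hux, hx_eq⟩ := hy.2.1.surjOn hxy
  have h1 := transfer_adj hx hy hty hy_eq ht hu hzu
  have h1' := transfer_adj hx hy hty hy_eq ht' hu' hzu'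
  have h2 := transfer_adj hy hx hux hx_eq hu ht hzu.symm
  have h2' := transfer_adj hy hx hux hx_eq hu' ht' hzu'.symm
  have htt : t ≠ t' := by
    rintro rfl
    rw [sub_self, transfer_sqNormInt_zero] at h48
    omega
  have huu : u ≠ u' := by
    rintro rfl
    exact htt (hx.2.1.injOn ht ht' (by rw [hzu, hzu']))
  obtain ⟨t'', ht'', ha, hb, hc⟩ := (transfer_apex hx.1 hty ht ht' h1 h1' htt).1 h48
  have hw : nbr t'' ∈ shell S y := by rw [← hy_eq]; exact (hx.2.2.2 ty hty t'' ht'').2 ha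
  obtain ⟨u'', hu'', hw_eq⟩ := hy.2.1.surjOn hw
  have ha' : sqNormInt (ux - u'') = 18 := transfer_adj hy hx hux hx_eq hu'' ht'' hw_eq
  have hb' : sqNormInt (u'' - u) = 18 :=
    (hy.2.2.2 u'' hu'' u hu).1 (by rw [hw_eq, ← hzu]; exact (hx.2.2.2 t'' ht'' t ht).2 hb)
  have hc' : sqNormInt (u'' - u') = 18 :=
    (hy.2.2.2 u'' hu'' u' hu').1 (by rw [hw_eq, ← hzu']; exact (hx.2.2.2 t'' ht'' t' ht').2 hc)
  exact (transfer_apex hy.1 hux hu hu' h2 h2' huu).2 ⟨u'', hu'', ha', hb', hc'⟩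

/-- **The core of the transfer**: the reading at `x` is never strictly below the reading at
`y`. [folklore] -/
theorem transfer_core (hx : IsZChart S x P A nbr) (hy : IsZChart S y Py Ay ny)
    (hyx : y ∈ shell S x) (hxy : x ∈ shell S y) {z z' : E3} {t t' u u' : Fin 3 → ℤ}
    (hz : (t = 0 ∧ z = x) ∨ (t ∈ P ∧ z = nbr t)) (hz' : (t' = 0 ∧ z' = x) ∨ (t' ∈ P ∧ z' = nbr t'))
    (hu : (u = 0 ∧ z = y) ∨ (u ∈ Py ∧ z = ny u)) (hu' : (u' = 0 ∧ z' = y) ∨ (u' ∈ Py ∧ z' = ny u')) :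
    ¬ sqNormInt (t - t') < sqNormInt (u - u') := by
  intro hlt
  have hd := transfer_nnd_pos hyx
  have hd' := transfer_nnd_pos hxy
  have htie := transfer_tied hy hyx hxy
  have h1 := transfer_reading hx hd.le hz hz'
  have h2 := transfer_reading hy hd'.le hu hu'
  have hD := transfer_xlabel_mem hx.1 hz hz'
  have hD' := transfer_xlabel_mem hy.1 hu hu'
  have hm : ¬ ((sqNormInt (t - t') = 0 ∧ 18 ≤ sqNormInt (u - u')) ∨
      (sqNormInt (t - t') = 18 ∧ 36 ≤ sqNormInt (u - u')) ∨
      (sqNormInt (t - t') = 36 ∧ sqNormInt (u - u') = 54)) :=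
    fun hc => transfer_metric hd' htie hc h1 h2
  simp only [Finset.mem_insert, Finset.mem_singleton] at hD hD'
  have h18 : 18 < sqNormInt (t - t') := by omega
  obtain ⟨⟨ht, rfl⟩, ⟨ht', rfl⟩⟩ := transfer_labels hx.1 hz hz' h18
  obtain ⟨⟨hu₁, hzu⟩, ⟨hu₁', hzu'⟩⟩ := transfer_labels hy.1 hu hu' (by omega)
  have h5 := transfer_mem5 hx hy hyx ht ht' hu₁ hu₁' hzu hzu'
  have h5' := transfer_mem5 hy hx hxy hu₁ hu₁' ht ht' hzu.symm hzu'.symm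
  have h48 : sqNormInt (t - t') = 48 → sqNormInt (u - u') = 48 :=
    transfer_48 hx hy hyx hxy ht ht' hu₁ hu₁' hzu hzu'
  have h48' : sqNormInt (u - u') = 48 → sqNormInt (t - t') = 48 :=
    transfer_48 hy hx hxy hyx hu₁ hu₁' ht ht' hzu.symm hzu'.symm
  simp only [Finset.mem_insert, Finset.mem_singleton] at h5 h5'
  omega

end Core

/-- SUB-GOAL `develop_transfer` (registered on stmt-12088; toward `develop_transport`): THE
TRANSFER LEMMA at tolerance `1/20` — for two mutually shell-adjacent sites `x`, `y` with integer
charts and two points `z, z'` each of which is `x` (label `0`) or a labelled shell point of `x`,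
AND `y` or a labelled shell point of `y`, the squared label distance of `z, z'` read at `y` equals
the one read at `x`. -/
theorem develop_transfer :
    ∀ (S : Set E3) (x y : E3) (P Py : Finset (Fin 3 → ℤ)) (A Ay : E3 →ₗᵢ[ℝ] E3)
      (nbr ny : (Fin 3 → ℤ) → E3), IsZChart S x P A nbr → IsZChart S y Py Ay ny →
      y ∈ shell S x → x ∈ shell S y →
      ∀ (z z' : E3) (t t' u u' : Fin 3 → ℤ),
        ((t = 0 ∧ z = x) ∨ (t ∈ P ∧ z = nbr t)) → ((t' = 0 ∧ z' = x) ∨ (t' ∈ P ∧ z' = nbr t')) →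
        ((u = 0 ∧ z = y) ∨ (u ∈ Py ∧ z = ny u)) → ((u' = 0 ∧ z' = y) ∨ (u' ∈ Py ∧ z' = ny u')) →
        sqNormInt (u - u') = sqNormInt (t - t') := by
  intro S x y P Py A Ay nbr ny hx hy hyx hxy z z' t t' u u' hz hz' hu hu'
  rcases lt_trichotomy (sqNormInt (t - t')) (sqNormInt (u - u')) with h | h | h
  · exact absurd h (transfer_core hx hy hyx hxy hz hz' hu hu')
  · exact h.symm
  · exact absurd h (transfer_core hy hx hxy hyx hu hu' hz hz')

end Summit.AtomisticToContinuum.Crystallization.Theorems.HullExactificationCascadeRobustBarlowTemplate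

end
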